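import Summits.CriticalPhenomena.PercolationContinuityZ3.Theorems.PercNearOneGluingNoHeavyLowerTailSahiThreeChainSlotForm
import Summits.CriticalPhenomena.PercolationContinuityZ3.Theorems.PercNearOneGluingNoHeavyLowerTailSahiTwoChainWRCoefficients

/-!
# Sahi's `C₃` in dimension three, II-b: THE ORDER-3 BRIDGE — `E₃` under a triple product weight is `(1/216)·Σ` of the slot form over slot maps

Support file of the one-cut programme (crux `NoHeavyLowerTail`, stmt-CriticalPhenomena-4575; cell `prim-masterthm`, seat P3, gen 17;
`run/shared/lean/prim/prim-masterthm/prim-masterthm-p3/HIERARCHY.md` §25; memo `run/shared/lean/prim/prim-masterthm/FROM-prim-masterthm-p3-g17-THREE-CHAINS-C3.md`).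
Second of three files (`…SlotForm` → this → `…OrderThree`).

* `slotMap r s t : [3]³ → α×β×γ`, `(a,b,c) ↦ (r_a, s_b, t_c)`; `prodWeight3 ν ν′ ν″` the triple product weight; `slotWeight` the monomial weight `Πν(r)Πν′(s)Πν″(t)`.
* `sum_pi_peel_one/two/three` — marginalising one, two, three distinct coordinates of `Fin n → α` under `Π ν(r_j)` (from gen 16's
  `SahiTwoChain.sum_pi_weight_split`); `sum_slot_one/two/three` — a `k`-tuple of pairwise NON-ATTACKING slots reads `k` INDEPENDENT points:
  `Σ_{r,s,t} w·Π_i F_i(π z_i) = Π_i E[F_i]` (`k = 1,2,3`).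
* **`SahiThreeChain.sahiE_three_prodWeight3_eq`** — for probability vectors `ν, ν′, ν″` on finite types `α, β, γ` and ANY `f : Fin 3 → α×β×γ → ℝ`:
  `E₃^{ν⊗ν′⊗ν″}(f) = (1/216)·Σ_{r,s,t : Fin 3 → α,β,γ} (Πν(r_a))(Πν′(s_b))(Πν″(t_c)) · T(f₀∘π_{rst}, f₁∘π_{rst}, f₂∘π_{rst})` — the order-3, dimension-3 case of the
  coefficient bridge of the without-replacement device (gen 16 `SahiTwoChain.sahiE_prodWeight_eq_sum_et` is order-`n`, dimension 2), proved DIRECTLY from Sahi's closed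
  form `sahiE_three_apply` and the slot lemmas (`27·16/216 = 2`, `216/216 = 1`).
Everything here is proved; axioms standard. [this work]
-/

noncomputable section

namespace Summit.CriticalPhenomena.PercolationContinuityZ3.Theorems

open Finset Function
open Literature.Combinatorics.Sahi2008

namespace SahiThreeChain

section Bridge

variable {α β γ : Type*} [Fintype α] [Fintype β] [Fintype γ]

/-- The slot map `π_{r,s,t} : [3]³ → α×β×γ`, `(a,b,c) ↦ (r_a, s_b, t_c)`. [this work] -/
def slotMap (r : Fin 3 → α) (s : Fin 3 → β) (t : Fin 3 → γ) : P → α × β × γ := fun z => (r z.1, s z.2.1, t z.2.2)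

omit [Fintype α] [Fintype β] [Fintype γ] in
/-- The slot map, pointwise. [this work] -/
theorem slotMap_apply (r : Fin 3 → α) (s : Fin 3 → β) (t : Fin 3 → γ) (z : P) : slotMap r s t z = (r z.1, s z.2.1, t z.2.2) := rfl

omit [Fintype β] [Fintype γ] in
/-- Peeling ONE coordinate: `Σ_{r : Fin (n+1) → α} (Πν(r_j))·Ψ(r_p) = Σ_x ν(x)Ψ(x)` when `Σν = 1`. [this work] -/
theorem sum_pi_peel_one (ν : α → ℝ) (hν : ∑ x, ν x = 1) {n : ℕ} (p : Fin (n + 1)) (Ψ : α → ℝ) :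
    ∑ r : Fin (n + 1) → α, (∏ j, ν (r j)) * Ψ (r p) = ∑ x, ν x * Ψ x := by
  rw [SahiTwoChain.sum_pi_weight_split ν p (fun x _ => Ψ x)]
  refine Fintype.sum_congr _ _ fun x => ?_
  have hw : ∑ r' : Fin n → α, ∏ j, ν (r' j) = 1 := by
    have hps := Finset.prod_univ_sum (fun _ : Fin n => (univ : Finset α)) (fun _ x => ν x)
    rw [Fintype.piFinset_univ] at hps
    rw [← hps]
    simp [hν]
  calc ∑ r' : Fin n → α, (ν x * ∏ j, ν (r' j)) * Ψ x = (ν x * Ψ x) * ∑ r' : Fin n → α, ∏ j, ν (r' j) := by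
        rw [Finset.mul_sum]; exact Fintype.sum_congr _ _ fun r' => by ring
    _ = ν x * Ψ x := by rw [hw, mul_one]

omit [Fintype β] [Fintype γ] in
/-- Peeling TWO distinct coordinates: `Σ_r (Πν(r_j))·Ψ(r_p, r_q) = Σ_{x,x'} ν(x)ν(x')Ψ(x,x')` (`p ≠ q`, `Σν = 1`). [this work] -/
theorem sum_pi_peel_two (ν : α → ℝ) (hν : ∑ x, ν x = 1) {n : ℕ} (p q : Fin (n + 2)) (hpq : p ≠ q) (Ψ : α → α → ℝ) :
    ∑ r : Fin (n + 2) → α, (∏ j, ν (r j)) * Ψ (r p) (r q) = ∑ x, ∑ x', ν x * ν x' * Ψ x x' := by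
  obtain ⟨q', hq'⟩ := Fin.exists_succAbove_eq (Ne.symm hpq)
  have h := SahiTwoChain.sum_pi_weight_split ν p (fun x r' => Ψ x (r' q'))
  simp only [hq'] at h
  rw [h]
  refine Fintype.sum_congr _ _ fun x => ?_
  have h2 := sum_pi_peel_one ν hν q' (fun x' => Ψ x x')
  calc ∑ r' : Fin (n + 1) → α, (ν x * ∏ j, ν (r' j)) * Ψ x (r' q')
        = ν x * ∑ r' : Fin (n + 1) → α, (∏ j, ν (r' j)) * Ψ x (r' q') := by
          rw [Finset.mul_sum]; exact Fintype.sum_congr _ _ fun r' => by ring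
    _ = ∑ x', ν x * ν x' * Ψ x x' := by
          rw [h2, Finset.mul_sum]; exact Fintype.sum_congr _ _ fun x' => by ring

omit [Fintype β] [Fintype γ] in
/-- Peeling THREE pairwise distinct coordinates of `Fin 3 → α`. [this work] -/
theorem sum_pi_peel_three (ν : α → ℝ) (hν : ∑ x, ν x = 1) (p q u : Fin 3) (hpq : p ≠ q) (hpu : p ≠ u) (hqu : q ≠ u)
    (Ψ : α → α → α → ℝ) :
    ∑ r : Fin 3 → α, (∏ j, ν (r j)) * Ψ (r p) (r q) (r u) = ∑ x, ∑ x', ∑ x'', ν x * ν x' * ν x'' * Ψ x x' x'' := by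
  obtain ⟨q', hq'⟩ := Fin.exists_succAbove_eq (Ne.symm hpq)
  obtain ⟨u', hu'⟩ := Fin.exists_succAbove_eq (Ne.symm hpu)
  have hq'u' : q' ≠ u' := by
    intro h; apply hqu; rw [← hq', ← hu', h]
  have h := SahiTwoChain.sum_pi_weight_split ν p (fun x r' => Ψ x (r' q') (r' u'))
  simp only [hq', hu'] at h
  rw [h]
  refine Fintype.sum_congr _ _ fun x => ?_
  have h2 := sum_pi_peel_two ν hν q' u' hq'u' (fun x' x'' => Ψ x x' x'')
  calc ∑ r' : Fin 2 → α, (ν x * ∏ j, ν (r' j)) * Ψ x (r' q') (r' u')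
        = ν x * ∑ r' : Fin 2 → α, (∏ j, ν (r' j)) * Ψ x (r' q') (r' u') := by
          rw [Finset.mul_sum]; exact Fintype.sum_congr _ _ fun r' => by ring
    _ = ∑ x', ∑ x'', ν x * ν x' * ν x'' * Ψ x x' x'' := by
          rw [h2, Finset.mul_sum]
          refine Fintype.sum_congr _ _ fun x' => ?_
          rw [Finset.mul_sum]
          exact Fintype.sum_congr _ _ fun x'' => by ring

/-- The triple product weight `μ(x,y,u) = ν(x)ν′(y)ν″(u)`. [this work] -/
def prodWeight3 (ν : α → ℝ) (ν' : β → ℝ) (ν'' : γ → ℝ) : α × β × γ → ℝ := fun p => ν p.1 * ν' p.2.1 * ν'' p.2.2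

/-- Expectation under the triple product weight as an iterated sum. [this work] -/
theorem ex_prodWeight3 (ν : α → ℝ) (ν' : β → ℝ) (ν'' : γ → ℝ) (F : α × β × γ → ℝ) :
    ex (prodWeight3 ν ν' ν'') F = ∑ x, ∑ y, ∑ u, ν x * ν' y * ν'' u * F (x, y, u) := by
  rw [ex_def, Fintype.sum_prod_type]
  refine Fintype.sum_congr _ _ fun x => ?_
  rw [Fintype.sum_prod_type]
  rfl

/-- The monomial weight of a triple of slot maps. [this work] -/
def slotWeight (ν : α → ℝ) (ν' : β → ℝ) (ν'' : γ → ℝ) (r : Fin 3 → α) (s : Fin 3 → β) (t : Fin 3 → γ) : ℝ :=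
  (∏ j, ν (r j)) * ((∏ j, ν' (s j)) * ∏ j, ν'' (t j))

/-- ONE slot reads one point: `Σ_{r,s,t} w·F(π z) = E[F]`. [this work] -/
theorem sum_slot_one (ν : α → ℝ) (ν' : β → ℝ) (ν'' : γ → ℝ) (hν : ∑ x, ν x = 1) (hν' : ∑ y, ν' y = 1) (hν'' : ∑ u, ν'' u = 1)
    (F : α × β × γ → ℝ) (z : P) :
    ∑ r : Fin 3 → α, ∑ s : Fin 3 → β, ∑ t : Fin 3 → γ, slotWeight ν ν' ν'' r s t * F (slotMap r s t z) =
      ex (prodWeight3 ν ν' ν'') F := by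
  rw [ex_prodWeight3]
  simp only [slotWeight, slotMap_apply]
  have step : ∀ (r : Fin 3 → α) (s : Fin 3 → β),
      ∑ t : Fin 3 → γ, (∏ j, ν (r j)) * ((∏ j, ν' (s j)) * ∏ j, ν'' (t j)) * F (r z.1, s z.2.1, t z.2.2) =
        (∏ j, ν (r j)) * ((∏ j, ν' (s j)) * ∑ u, ν'' u * F (r z.1, s z.2.1, u)) := by
    intro r s
    rw [← sum_pi_peel_one ν'' hν'' z.2.2 (fun u => F (r z.1, s z.2.1, u)), Finset.mul_sum, Finset.mul_sum]
    exact Fintype.sum_congr _ _ fun t => by ring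
  simp_rw [step]
  have step2 : ∀ r : Fin 3 → α, ∑ s : Fin 3 → β, (∏ j, ν (r j)) * ((∏ j, ν' (s j)) * ∑ u, ν'' u * F (r z.1, s z.2.1, u)) =
      (∏ j, ν (r j)) * ∑ y, ν' y * ∑ u, ν'' u * F (r z.1, y, u) := by
    intro r
    rw [← sum_pi_peel_one ν' hν' z.2.1 (fun y => ∑ u, ν'' u * F (r z.1, y, u)), Finset.mul_sum]
  simp_rw [step2]
  rw [sum_pi_peel_one ν hν z.1 (fun x => ∑ y, ν' y * ∑ u, ν'' u * F (x, y, u))]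
  refine Fintype.sum_congr _ _ fun x => ?_
  rw [Finset.mul_sum]
  refine Fintype.sum_congr _ _ fun y => ?_
  rw [Finset.mul_sum, Finset.mul_sum]
  exact Fintype.sum_congr _ _ fun u => by ring

/-- TWO non-attacking slots read two INDEPENDENT points: `Σ_{r,s,t} w·G(π z)·H(π z') = E[G]·E[H]`. [this work] -/
theorem sum_slot_two (ν : α → ℝ) (ν' : β → ℝ) (ν'' : γ → ℝ) (hν : ∑ x, ν x = 1) (hν' : ∑ y, ν' y = 1) (hν'' : ∑ u, ν'' u = 1)
    (G H : α × β × γ → ℝ) {z z' : P} (hzz' : NonAtt z z') :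
    ∑ r : Fin 3 → α, ∑ s : Fin 3 → β, ∑ t : Fin 3 → γ, slotWeight ν ν' ν'' r s t * (G (slotMap r s t z) * H (slotMap r s t z')) =
      ex (prodWeight3 ν ν' ν'') G * ex (prodWeight3 ν ν' ν'') H := by
  obtain ⟨h1, h2, h3⟩ := hzz'
  simp only [slotWeight, slotMap_apply]
  have step : ∀ (r : Fin 3 → α) (s : Fin 3 → β),
      ∑ t : Fin 3 → γ, (∏ j, ν (r j)) * ((∏ j, ν' (s j)) * ∏ j, ν'' (t j)) * (G (r z.1, s z.2.1, t z.2.2) * H (r z'.1, s z'.2.1, t z'.2.2)) =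
        (∏ j, ν (r j)) * ((∏ j, ν' (s j)) * ∑ u, ∑ u', ν'' u * ν'' u' * (G (r z.1, s z.2.1, u) * H (r z'.1, s z'.2.1, u'))) := by
    intro r s
    rw [← sum_pi_peel_two ν'' hν'' z.2.2 z'.2.2 h3 (fun u u' => G (r z.1, s z.2.1, u) * H (r z'.1, s z'.2.1, u')),
      Finset.mul_sum, Finset.mul_sum]
    exact Fintype.sum_congr _ _ fun t => by ring
  simp_rw [step]
  have step2 : ∀ r : Fin 3 → α,
      ∑ s : Fin 3 → β, (∏ j, ν (r j)) * ((∏ j, ν' (s j)) * ∑ u, ∑ u', ν'' u * ν'' u' * (G (r z.1, s z.2.1, u) * H (r z'.1, s z'.2.1, u'))) =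
        (∏ j, ν (r j)) * ∑ y, ∑ y', ν' y * ν' y' * ∑ u, ∑ u', ν'' u * ν'' u' * (G (r z.1, y, u) * H (r z'.1, y', u')) := by
    intro r
    rw [← sum_pi_peel_two ν' hν' z.2.1 z'.2.1 h2
      (fun y y' => ∑ u, ∑ u', ν'' u * ν'' u' * (G (r z.1, y, u) * H (r z'.1, y', u'))), Finset.mul_sum]
  simp_rw [step2]
  rw [sum_pi_peel_two ν hν z.1 z'.1 h1
    (fun x x' => ∑ y, ∑ y', ν' y * ν' y' * ∑ u, ∑ u', ν'' u * ν'' u' * (G (x, y, u) * H (x', y', u')))]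
  rw [ex_prodWeight3, ex_prodWeight3]
  -- normalise both sides to the same 6-fold sum
  have rhs : (∑ x, ∑ y, ∑ u, ν x * ν' y * ν'' u * G (x, y, u)) * (∑ x', ∑ y', ∑ u', ν x' * ν' y' * ν'' u' * H (x', y', u')) =
      ∑ x, ∑ x', ∑ y, ∑ y', ∑ u, ∑ u', (ν x * ν' y * ν'' u * G (x, y, u)) * (ν x' * ν' y' * ν'' u' * H (x', y', u')) := by
    rw [Finset.sum_mul_sum]
    refine Fintype.sum_congr _ _ fun x => ?_
    refine Fintype.sum_congr _ _ fun x' => ?_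
    rw [Finset.sum_mul_sum]
    refine Fintype.sum_congr _ _ fun y => ?_
    refine Fintype.sum_congr _ _ fun y' => ?_
    rw [Finset.sum_mul_sum]
  rw [rhs]
  refine Fintype.sum_congr _ _ fun x => ?_
  refine Fintype.sum_congr _ _ fun x' => ?_
  simp only [Finset.mul_sum]
  refine Finset.sum_congr rfl fun y _ => ?_
  refine Finset.sum_congr rfl fun y' _ => ?_
  refine Finset.sum_congr rfl fun u _ => ?_
  refine Finset.sum_congr rfl fun u' _ => ?_
  ring

/-- THREE pairwise non-attacking slots read three INDEPENDENT points. [this work] -/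
theorem sum_slot_three (ν : α → ℝ) (ν' : β → ℝ) (ν'' : γ → ℝ) (hν : ∑ x, ν x = 1) (hν' : ∑ y, ν' y = 1) (hν'' : ∑ u, ν'' u = 1)
    (F G H : α × β × γ → ℝ) {z z' z'' : P} (h₁ : NonAtt z z') (h₂ : NonAtt z z'') (h₃ : NonAtt z' z'') :
    ∑ r : Fin 3 → α, ∑ s : Fin 3 → β, ∑ t : Fin 3 → γ,
        slotWeight ν ν' ν'' r s t * (F (slotMap r s t z) * G (slotMap r s t z') * H (slotMap r s t z'')) =
      ex (prodWeight3 ν ν' ν'') F * ex (prodWeight3 ν ν' ν'') G * ex (prodWeight3 ν ν' ν'') H := by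
  obtain ⟨a1, a2, a3⟩ := h₁
  obtain ⟨b1, b2, b3⟩ := h₂
  obtain ⟨c1, c2, c3⟩ := h₃
  simp only [slotWeight, slotMap_apply]
  have step : ∀ (r : Fin 3 → α) (s : Fin 3 → β),
      ∑ t : Fin 3 → γ, (∏ j, ν (r j)) * ((∏ j, ν' (s j)) * ∏ j, ν'' (t j)) *
          (F (r z.1, s z.2.1, t z.2.2) * G (r z'.1, s z'.2.1, t z'.2.2) * H (r z''.1, s z''.2.1, t z''.2.2)) =
        (∏ j, ν (r j)) * ((∏ j, ν' (s j)) * ∑ u, ∑ u', ∑ u'', ν'' u * ν'' u' * ν'' u'' *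
          (F (r z.1, s z.2.1, u) * G (r z'.1, s z'.2.1, u') * H (r z''.1, s z''.2.1, u''))) := by
    intro r s
    rw [← sum_pi_peel_three ν'' hν'' z.2.2 z'.2.2 z''.2.2 a3 b3 c3
      (fun u u' u'' => F (r z.1, s z.2.1, u) * G (r z'.1, s z'.2.1, u') * H (r z''.1, s z''.2.1, u'')), Finset.mul_sum, Finset.mul_sum]
    exact Fintype.sum_congr _ _ fun t => by ring
  simp_rw [step]
  have step2 : ∀ r : Fin 3 → α,
      ∑ s : Fin 3 → β, (∏ j, ν (r j)) * ((∏ j, ν' (s j)) * ∑ u, ∑ u', ∑ u'', ν'' u * ν'' u' * ν'' u'' *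
          (F (r z.1, s z.2.1, u) * G (r z'.1, s z'.2.1, u') * H (r z''.1, s z''.2.1, u''))) =
        (∏ j, ν (r j)) * ∑ y, ∑ y', ∑ y'', ν' y * ν' y' * ν' y'' * ∑ u, ∑ u', ∑ u'', ν'' u * ν'' u' * ν'' u'' *
          (F (r z.1, y, u) * G (r z'.1, y', u') * H (r z''.1, y'', u'')) := by
    intro r
    rw [← sum_pi_peel_three ν' hν' z.2.1 z'.2.1 z''.2.1 a2 b2 c2
      (fun y y' y'' => ∑ u, ∑ u', ∑ u'', ν'' u * ν'' u' * ν'' u'' * (F (r z.1, y, u) * G (r z'.1, y', u') * H (r z''.1, y'', u''))),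
      Finset.mul_sum]
  simp_rw [step2]
  rw [sum_pi_peel_three ν hν z.1 z'.1 z''.1 a1 b1 c1 (fun x x' x'' => ∑ y, ∑ y', ∑ y'', ν' y * ν' y' * ν' y'' *
    ∑ u, ∑ u', ∑ u'', ν'' u * ν'' u' * ν'' u'' * (F (x, y, u) * G (x', y', u') * H (x'', y'', u'')))]
  rw [ex_prodWeight3, ex_prodWeight3, ex_prodWeight3]
  have rhs : (∑ x, ∑ y, ∑ u, ν x * ν' y * ν'' u * F (x, y, u)) * (∑ x', ∑ y', ∑ u', ν x' * ν' y' * ν'' u' * G (x', y', u')) *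
      (∑ x'', ∑ y'', ∑ u'', ν x'' * ν' y'' * ν'' u'' * H (x'', y'', u'')) =
      ∑ x, ∑ x', ∑ x'', ∑ y, ∑ y', ∑ y'', ∑ u, ∑ u', ∑ u'',
        (ν x * ν' y * ν'' u * F (x, y, u)) * ((ν x' * ν' y' * ν'' u' * G (x', y', u')) * (ν x'' * ν' y'' * ν'' u'' * H (x'', y'', u''))) := by
    rw [mul_assoc, Finset.sum_mul_sum, Finset.sum_mul_sum]
    refine Fintype.sum_congr _ _ fun x => ?_
    refine Fintype.sum_congr _ _ fun x' => ?_
    rw [Finset.mul_sum]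
    refine Fintype.sum_congr _ _ fun x'' => ?_
    rw [Finset.sum_mul_sum, Finset.sum_mul_sum]
    refine Fintype.sum_congr _ _ fun y => ?_
    refine Fintype.sum_congr _ _ fun y' => ?_
    rw [Finset.mul_sum]
    refine Fintype.sum_congr _ _ fun y'' => ?_
    rw [Finset.sum_mul_sum, Finset.sum_mul_sum]
    refine Fintype.sum_congr _ _ fun u => ?_
    refine Fintype.sum_congr _ _ fun u' => ?_
    rw [Finset.mul_sum]
  rw [rhs]
  refine Fintype.sum_congr _ _ fun x => ?_
  refine Fintype.sum_congr _ _ fun x' => ?_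
  refine Fintype.sum_congr _ _ fun x'' => ?_
  simp only [Finset.mul_sum]
  refine Finset.sum_congr rfl fun y _ => ?_
  refine Finset.sum_congr rfl fun y' _ => ?_
  refine Finset.sum_congr rfl fun y'' _ => ?_
  refine Finset.sum_congr rfl fun u _ => ?_
  refine Finset.sum_congr rfl fun u' _ => ?_
  refine Finset.sum_congr rfl fun u'' _ => ?_
  ring

/-! #### The bridge -/

/-- Moving the slot-map sum inside a sum over cells. [this work] -/
theorem sum_slot_comm (Φ : (Fin 3 → α) → (Fin 3 → β) → (Fin 3 → γ) → P → ℝ) :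
    ∑ r : Fin 3 → α, ∑ s : Fin 3 → β, ∑ t : Fin 3 → γ, ∑ z : P, Φ r s t z =
      ∑ z : P, ∑ r : Fin 3 → α, ∑ s : Fin 3 → β, ∑ t : Fin 3 → γ, Φ r s t z := by
  simp_rw [Finset.sum_comm (s := (univ : Finset (Fin 3 → γ))) (t := (univ : Finset P))]
  simp_rw [Finset.sum_comm (s := (univ : Finset (Fin 3 → β))) (t := (univ : Finset P))]
  rw [Finset.sum_comm (s := (univ : Finset (Fin 3 → α))) (t := (univ : Finset P))]

/-- **THE ORDER-3 BRIDGE IN DIMENSION 3.**  For probability vectors `ν, ν′, ν″` and any `f : Fin 3 → α×β×γ → ℝ`,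
`E₃^{ν⊗ν′⊗ν″}(f) = (1/216)·Σ_{r,s,t} w(r,s,t)·T(f₀∘π_{rst}, f₁∘π_{rst}, f₂∘π_{rst})`. [this work] -/
theorem sahiE_three_prodWeight3_eq (ν : α → ℝ) (ν' : β → ℝ) (ν'' : γ → ℝ) (hν : ∑ x, ν x = 1) (hν' : ∑ y, ν' y = 1)
    (hν'' : ∑ u, ν'' u = 1) (f : Fin 3 → α × β × γ → ℝ) :
    sahiE (prodWeight3 ν ν' ν'') 3 f = (1 / 216) * ∑ r : Fin 3 → α, ∑ s : Fin 3 → β, ∑ t : Fin 3 → γ,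
      slotWeight ν ν' ν'' r s t * T (f 0 ∘ slotMap r s t) (f 1 ∘ slotMap r s t) (f 2 ∘ slotMap r s t) := by
  set μ := prodWeight3 ν ν' ν'' with hμ
  -- the three pieces of `T`, summed against the slot weights
  have piece1 : ∑ r : Fin 3 → α, ∑ s : Fin 3 → β, ∑ t : Fin 3 → γ,
      slotWeight ν ν' ν'' r s t * ∑ z, (f 0 ∘ slotMap r s t) z * (f 1 ∘ slotMap r s t) z * (f 2 ∘ slotMap r s t) z =
      27 * ex μ (f 0 * f 1 * f 2) := by
    simp_rw [Finset.mul_sum]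
    rw [sum_slot_comm]
    have hz : ∀ z : P, ∑ r : Fin 3 → α, ∑ s : Fin 3 → β, ∑ t : Fin 3 → γ,
        slotWeight ν ν' ν'' r s t * ((f 0 ∘ slotMap r s t) z * (f 1 ∘ slotMap r s t) z * (f 2 ∘ slotMap r s t) z) =
        ex μ (f 0 * f 1 * f 2) := fun z => by
      simpa only [Pi.mul_apply, Function.comp_apply] using sum_slot_one ν ν' ν'' hν hν' hν'' (f 0 * f 1 * f 2) z
    simp_rw [hz]
    rw [Finset.sum_const, Finset.card_univ]
    have : Fintype.card P = 27 := by simp [P, Fintype.card_prod, Fintype.card_fin]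
    rw [this]
    norm_num
  have piece2 : ∑ r : Fin 3 → α, ∑ s : Fin 3 → β, ∑ t : Fin 3 → γ,
      slotWeight ν ν' ν'' r s t * ∑ z, ∑ z', nw z z' *
        ((f 0 ∘ slotMap r s t) z * (f 1 ∘ slotMap r s t) z * (f 2 ∘ slotMap r s t) z' +
          (f 0 ∘ slotMap r s t) z * (f 2 ∘ slotMap r s t) z * (f 1 ∘ slotMap r s t) z' +
          (f 1 ∘ slotMap r s t) z * (f 2 ∘ slotMap r s t) z * (f 0 ∘ slotMap r s t) z') =
      216 * (ex μ (f 0 * f 1) * ex μ (f 2) + ex μ (f 0 * f 2) * ex μ (f 1) + ex μ (f 1 * f 2) * ex μ (f 0)) := by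
    simp_rw [Finset.mul_sum]
    rw [sum_slot_comm]
    have hz : ∀ z : P, ∑ r : Fin 3 → α, ∑ s : Fin 3 → β, ∑ t : Fin 3 → γ, ∑ z', slotWeight ν ν' ν'' r s t * (nw z z' *
        ((f 0 ∘ slotMap r s t) z * (f 1 ∘ slotMap r s t) z * (f 2 ∘ slotMap r s t) z' +
          (f 0 ∘ slotMap r s t) z * (f 2 ∘ slotMap r s t) z * (f 1 ∘ slotMap r s t) z' +
          (f 1 ∘ slotMap r s t) z * (f 2 ∘ slotMap r s t) z * (f 0 ∘ slotMap r s t) z')) =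
        ∑ z', nw z z' * (ex μ (f 0 * f 1) * ex μ (f 2) + ex μ (f 0 * f 2) * ex μ (f 1) + ex μ (f 1 * f 2) * ex μ (f 0)) := by
      intro z
      rw [sum_slot_comm]
      refine Fintype.sum_congr _ _ fun z' => ?_
      by_cases hzz' : NonAtt z z'
      · have e1 : ∑ r : Fin 3 → α, ∑ s : Fin 3 → β, ∑ t : Fin 3 → γ, slotWeight ν ν' ν'' r s t *
            (f 0 (slotMap r s t z) * f 1 (slotMap r s t z) * f 2 (slotMap r s t z')) = ex μ (f 0 * f 1) * ex μ (f 2) := by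
          simpa only [Pi.mul_apply] using sum_slot_two ν ν' ν'' hν hν' hν'' (f 0 * f 1) (f 2) hzz'
        have e2 : ∑ r : Fin 3 → α, ∑ s : Fin 3 → β, ∑ t : Fin 3 → γ, slotWeight ν ν' ν'' r s t *
            (f 0 (slotMap r s t z) * f 2 (slotMap r s t z) * f 1 (slotMap r s t z')) = ex μ (f 0 * f 2) * ex μ (f 1) := by
          simpa only [Pi.mul_apply] using sum_slot_two ν ν' ν'' hν hν' hν'' (f 0 * f 2) (f 1) hzz'
        have e3 : ∑ r : Fin 3 → α, ∑ s : Fin 3 → β, ∑ t : Fin 3 → γ, slotWeight ν ν' ν'' r s t *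
            (f 1 (slotMap r s t z) * f 2 (slotMap r s t z) * f 0 (slotMap r s t z')) = ex μ (f 1 * f 2) * ex μ (f 0) := by
          simpa only [Pi.mul_apply] using sum_slot_two ν ν' ν'' hν hν' hν'' (f 1 * f 2) (f 0) hzz'
        have hsplit : ∀ (r : Fin 3 → α) (s : Fin 3 → β) (t : Fin 3 → γ), slotWeight ν ν' ν'' r s t * (nw z z' *
            ((f 0 ∘ slotMap r s t) z * (f 1 ∘ slotMap r s t) z * (f 2 ∘ slotMap r s t) z' +
              (f 0 ∘ slotMap r s t) z * (f 2 ∘ slotMap r s t) z * (f 1 ∘ slotMap r s t) z' +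
              (f 1 ∘ slotMap r s t) z * (f 2 ∘ slotMap r s t) z * (f 0 ∘ slotMap r s t) z')) =
            nw z z' * (slotWeight ν ν' ν'' r s t * (f 0 (slotMap r s t z) * f 1 (slotMap r s t z) * f 2 (slotMap r s t z'))) +
            nw z z' * (slotWeight ν ν' ν'' r s t * (f 0 (slotMap r s t z) * f 2 (slotMap r s t z) * f 1 (slotMap r s t z'))) +
            nw z z' * (slotWeight ν ν' ν'' r s t * (f 1 (slotMap r s t z) * f 2 (slotMap r s t z) * f 0 (slotMap r s t z'))) := by
          intro r s t
          simp only [Function.comp_apply]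
          ring
        simp_rw [hsplit, Finset.sum_add_distrib, ← Finset.mul_sum]
        rw [e1, e2, e3]
        ring
      · have hw : nw z z' = 0 := by simp [nw, hzz']
        simp [hw]
    simp_rw [hz, ← Finset.sum_mul]
    rw [sum_sum_nw]
  have piece3 : ∑ r : Fin 3 → α, ∑ s : Fin 3 → β, ∑ t : Fin 3 → γ,
      slotWeight ν ν' ν'' r s t * ∑ z, ∑ z', ∑ z'', nw z z' * nw z z'' * nw z' z'' *
        ((f 0 ∘ slotMap r s t) z * (f 1 ∘ slotMap r s t) z' * (f 2 ∘ slotMap r s t) z'') =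
      216 * (ex μ (f 0) * ex μ (f 1) * ex μ (f 2)) := by
    simp_rw [Finset.mul_sum]
    rw [sum_slot_comm]
    have hz : ∀ z : P, ∑ r : Fin 3 → α, ∑ s : Fin 3 → β, ∑ t : Fin 3 → γ, ∑ z', ∑ z'', slotWeight ν ν' ν'' r s t *
        (nw z z' * nw z z'' * nw z' z'' * ((f 0 ∘ slotMap r s t) z * (f 1 ∘ slotMap r s t) z' * (f 2 ∘ slotMap r s t) z'')) =
        ∑ z', ∑ z'', nw z z' * nw z z'' * nw z' z'' * (ex μ (f 0) * ex μ (f 1) * ex μ (f 2)) := by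
      intro z
      rw [sum_slot_comm]
      refine Fintype.sum_congr _ _ fun z' => ?_
      rw [sum_slot_comm]
      refine Fintype.sum_congr _ _ fun z'' => ?_
      by_cases h₁ : NonAtt z z'
      · by_cases h₂ : NonAtt z z''
        · by_cases h₃ : NonAtt z' z''
          · have e : ∑ r : Fin 3 → α, ∑ s : Fin 3 → β, ∑ t : Fin 3 → γ, slotWeight ν ν' ν'' r s t *
                (f 0 (slotMap r s t z) * f 1 (slotMap r s t z') * f 2 (slotMap r s t z'')) = ex μ (f 0) * ex μ (f 1) * ex μ (f 2) :=
              sum_slot_three ν ν' ν'' hν hν' hν'' (f 0) (f 1) (f 2) h₁ h₂ h₃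
            have hsplit : ∀ (r : Fin 3 → α) (s : Fin 3 → β) (t : Fin 3 → γ), slotWeight ν ν' ν'' r s t *
                (nw z z' * nw z z'' * nw z' z'' * ((f 0 ∘ slotMap r s t) z * (f 1 ∘ slotMap r s t) z' * (f 2 ∘ slotMap r s t) z'')) =
                (nw z z' * nw z z'' * nw z' z'') * (slotWeight ν ν' ν'' r s t *
                  (f 0 (slotMap r s t z) * f 1 (slotMap r s t z') * f 2 (slotMap r s t z''))) := by
              intro r s t
              simp only [Function.comp_apply]
              ring
            simp_rw [hsplit, ← Finset.mul_sum]
            rw [e]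
          · have hw : nw z' z'' = 0 := by simp [nw, h₃]
            simp [hw]
        · have hw : nw z z'' = 0 := by simp [nw, h₂]
          simp [hw]
      · have hw : nw z z' = 0 := by simp [nw, h₁]
        simp [hw]
    simp_rw [hz, ← Finset.sum_mul]
    rw [sum_sum_sum_nw]
  -- assemble
  have hT : ∀ (r : Fin 3 → α) (s : Fin 3 → β) (t : Fin 3 → γ),
      slotWeight ν ν' ν'' r s t * T (f 0 ∘ slotMap r s t) (f 1 ∘ slotMap r s t) (f 2 ∘ slotMap r s t) =
      16 * (slotWeight ν ν' ν'' r s t * ∑ z, (f 0 ∘ slotMap r s t) z * (f 1 ∘ slotMap r s t) z * (f 2 ∘ slotMap r s t) z) -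
        slotWeight ν ν' ν'' r s t * (∑ z, ∑ z', nw z z' *
          ((f 0 ∘ slotMap r s t) z * (f 1 ∘ slotMap r s t) z * (f 2 ∘ slotMap r s t) z' +
            (f 0 ∘ slotMap r s t) z * (f 2 ∘ slotMap r s t) z * (f 1 ∘ slotMap r s t) z' +
            (f 1 ∘ slotMap r s t) z * (f 2 ∘ slotMap r s t) z * (f 0 ∘ slotMap r s t) z')) +
        slotWeight ν ν' ν'' r s t * ∑ z, ∑ z', ∑ z'', nw z z' * nw z z'' * nw z' z'' *
          ((f 0 ∘ slotMap r s t) z * (f 1 ∘ slotMap r s t) z' * (f 2 ∘ slotMap r s t) z'') := by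
    intro r s t
    unfold T
    ring
  simp_rw [hT, Finset.sum_add_distrib, Finset.sum_sub_distrib, ← Finset.mul_sum]
  rw [piece1, piece2, piece3, sahiE_three_apply]
  ring

end Bridge


end SahiThreeChain

end Summit.CriticalPhenomena.PercolationContinuityZ3.Theorems
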